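import Summits.CriticalPhenomena.PercolationContinuityZ3.Theorems.Transplant.FKConnectivityAllQDefs
import Summits.CriticalPhenomena.PercolationContinuityZ3.Theorems.PercNearOneGluingNoHeavyLowerTailFKHullPortTASections
import Summits.CriticalPhenomena.PercolationContinuityZ3.Theorems.PercNearOneGluingNoHeavyLowerTailHullPortTAStep
import Literature.Probability.Percolation.TwoAvoidanceSets
import HarnessLib

/-!
# Connectivity correlation inequalities for `φ_{w,q}`, every `q > 0` — file 4: pairwise positive correlation of
# two-point connection events FOLLOWS from single-edge monotonicity of connection probabilities (one-edge Bernstein induction)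

Support file (`--supports stmt-CriticalPhenomena-4575`), FK sub-lane `prim-bschramm-fk-2` (gen 6) of the post-continuity
programme; builds on p205010 (kernel theorem, internal audit signed; external expert review pending).  No named facts, no sorries;
standard axioms.  Continues fk-1 g4's `…FKConnectivityAllQDefs.lean` (conjecture nodes `PairConnPosFKPos ⊇ HubFKPos`).

THE STATEMENT `EdgeConnMonoOn V q` (EC⁺ on the finite vertex type `V`): for every weight vector `w`, every pair `e` and vertices
`x, y`, `φ_{w[e↦0],q}(x ↔ y) ≤ φ_{w[e↦1],q}(x ↔ y)` — opening one pair never lowers a two-point connection probability;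
equivalently `p_e ↦ φ_{𝐩,q}(x ↔ y)` is non-decreasing, i.e. `Cov_φ(1{x ↔ y}, ω(e)) ≥ 0` (`EdgeConnMonoFK q` = all `V = Fin n`).
For `q ≥ 1` this is the comparison inequality (Grimmett 2006, Thm. (3.21)); for `q < 1` no monotonicity in `𝐩` is available in
print (Grimmett 2006, §5.8: "absence of stochastic ordering and the failure of positive association"), and EC⁺ is there EQUIVALENT to
edge-negative association `φ(J_e ∩ J_f) ≤ φ(J_e)φ(J_f)` (Grimmett 2006, §3.9; typed in the companion file `…AllQEdgeNegCorr.lean`),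
conjectured for `q < 1` (Kahn 2000; Grimmett–Winkler 2004; Grimmett 2006, Conj. (3.96) for the `q ↓ 0` limits) and open.

PROVED HERE (kernel):
* `FK.pairConn_mass_le_of_edgeConnMonoOn` / **`FK.pairConnPosUnder_of_edgeConnMonoOn`** / **`FK.pairConnPosFK_of_edgeConnMonoFK`**:
  EC⁺ ⇒ ANY two two-point connection events are positively correlated, `φ(x ↔ y, u ↔ v) ≥ φ(x ↔ y) φ(u ↔ v)`, for every `q > 0`
  (hence the hub inequality `HubFK q`, Ayyer–Linusson–Ravichandran 2025 §7 (13), and in the arboreal-gas reading their Conj. 7.1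
  (15)).  PROOF: strong induction on the number of pairs with parameter in `(0,1)`; in a rigid state the measure is a point mass;
  otherwise deform one fractional pair `e` of parameter `t`: every mass `S_w(E) = ∑_ω w_q(ω) 1_E(ω)` is affine in `t`
  (`FK.rcWeightW_affine`), `Q(t) = S(A ∩ B)·Z − S(A)·S(B)` is a quadratic Bernstein combination of `Q` at the two corner states
  `w[e↦0]`, `w[e↦1]` (induction) and a mixed term, and prim-hp-7's identity
  `Z⁰Z¹·MIX = (Z⁰)²Q¹ + (Z¹)²Q⁰ + (Z⁰S¹(A) − Z¹S⁰(A))·(Z⁰S¹(B) − Z¹S⁰(B))` (`HullPort.bernstein_step`) closes the step because BOTH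
  brackets are `≥ 0` by EC⁺ — the only input.  No FKG, no lattice condition: the argument is insensitive to the sign of `q − 1`.
* `FK.rcMeasureW_real_openConn_mono_of_edgeConnMonoOn`: under EC⁺, `w ≤ w'` pointwise ⇒ `φ_{w,q}(x ↔ y) ≤ φ_{w',q}(x ↔ y)`.
* `FK.edgeConnMonoOn_of_one_le`: EC⁺ for `q ≥ 1` (tree: `rcMeasureW_real_mono_weights`), whence a second proof of
  `pairConnPosFK_of_one_le` that uses only single-edge monotonicity.
* Conjecture node `FK.EdgeConnMonoFKPos` (`∀ q > 0`, NOT asserted; census of this seat: 0 negatives on all connected graphs with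
  `≤ 7` vertices, 9.6 M cells, `q ∈ {0.8, …, 0.002}`; the `k`-point analogue FAILS for `k ≥ 4` at `q < 1`) and
  `pairConnPosFKPos_of_edgeConnMonoFKPos : EdgeConnMonoFKPos → PairConnPosFKPos` (⊇ `HubFKPos`).
[cite: Grimmett2006, Thm. (3.21) (p. 43); §3.9 (pp. 63–64); §5.8 (p. 131); §1.4 eq. (1.20) (p. 15)]
[cite: AyyerLinussonRavichandran2025, §7 eq. (13)–(15), Conj. 7.1 (pp. 22–23)]
-/

noncomputable section

namespace Summit.CriticalPhenomena.PercolationContinuityZ3.Theorems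

namespace FK

open MeasureTheory Set Literature.Probability.LatticeModels Literature.Probability.Percolation
open Literature.Probability.Percolation.DecisionTree (ind ind_of_mem ind_of_not_mem ind_nonneg)
open Summit.CriticalPhenomena.PercolationContinuityZ3.Theorems.HullPort (bernstein_step)
open scoped Classical

variable {V : Type*} [Fintype V]

/-! ### The statement EC⁺ and its conjecture node -/

/-- **Single-edge monotonicity of two-point connection probabilities for `φ_{w,q}` on the finite vertex type `V`** (EC⁺):
`φ_{w[e↦0],q}(x ↔ y) ≤ φ_{w[e↦1],q}(x ↔ y)` for every weight vector `w`, pair `e` and vertices `x, y` — equivalently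
`p_e ↦ φ_{𝐩,q}(x ↔ y)` is non-decreasing (`Cov_φ(1{x↔y}, ω(e)) ≥ 0`).  For `q ≥ 1` this is Grimmett's comparison inequality (3.21);
for `q < 1` it is equivalent to edge-negative association (§3.9) and conjectural.
[cite: Grimmett2006, Thm. (3.21) (p. 43); §3.9 (p. 63); §5.8 (p. 131)] -/
def EdgeConnMonoOn (V : Type*) [Fintype V] (q : ℝ) : Prop :=
  ∀ (w : Sym2 V → unitInterval) (e : Sym2 V) (x y : V),
    (rcMeasureW (Function.update w e 0) q ∅).real (openConn x y) ≤
      (rcMeasureW (Function.update w e 1) q ∅).real (openConn x y)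

/-- **EC⁺ for `φ_{w,q}` on every finite weighted graph** (vertex types `Fin n`, the lane's convention for `q`-families).
[cite: Grimmett2006, Thm. (3.21) (p. 43); §3.9 (p. 63)] -/
def EdgeConnMonoFK (q : ℝ) : Prop := ∀ n : ℕ, EdgeConnMonoOn (Fin n) q

/-- **EC⁺ for every `q > 0`.**  CONJECTURE-SHAPED STATEMENT, NOT asserted.  For `q ≥ 1` a theorem (`edgeConnMonoFK_of_one_le`);
for `0 < q < 1` equivalent to edge-negative association of `φ_{𝐩,q}` on all finite weighted graphs (Grimmett 2006 §3.9, conjectured,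
open; Kahn 2000 / Grimmett–Winkler 2004 for the `q ↓ 0` limits).  Evidence (this lane, fk-2 gen 6, 2026-08-20): 0 negatives on every
connected graph with `≤ 7` vertices (853 isomorphism classes, 8 weightings, `q ∈ {0.8, 0.5, 0.2, 0.05, 0.01, 0.002}`, 9.6·10⁶ cells);
the analogue for `k`-point connection events is FALSE for `k ≥ 4`, `q < 1` (exact witness on 6 vertices).
[cite: Grimmett2006, §3.9 (pp. 63–64); Conj. (3.96); §5.8 (p. 131)] -/
@[conjecture] def EdgeConnMonoFKPos : Prop := ∀ q : ℝ, 0 < q → EdgeConnMonoFK q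

/-! ### Masses `S_w(E) = ∑_ω w_q(ω)·1_E(ω)`: one-pair affine decomposition, rigid states -/

/-- The mass of an event is affine in each edge parameter: `S_w(E) = (1 − w e)·S_{w[e↦0]}(E) + (w e)·S_{w[e↦1]}(E)`.
[cite: Grimmett2006, §1.4 eq. (1.20) (p. 15); Thm. (3.1)(a) (p. 37)] -/
theorem sum_rcWeightW_ind_affine (w : Sym2 V → unitInterval) (q : ℝ) (e : Sym2 V) (E : Set (BondConfig V)) :
    ∑ ω : BondConfig V, rcWeightW w q ∅ ω * ind E ω =
      (1 - (w e : ℝ)) * ∑ ω : BondConfig V, rcWeightW (Function.update w e 0) q ∅ ω * ind E ω +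
        (w e : ℝ) * ∑ ω : BondConfig V, rcWeightW (Function.update w e 1) q ∅ ω * ind E ω := by
  rw [Finset.mul_sum, Finset.mul_sum, ← Finset.sum_add_distrib]
  refine Finset.sum_congr rfl fun ω _ => ?_
  rw [rcWeightW_affine w q ∅ e ω]
  ring

/-- The partition function is affine in each edge parameter: `Z_w = (1 − w e)·Z_{w[e↦0]} + (w e)·Z_{w[e↦1]}`.
[cite: Grimmett2006, §1.4 eq. (1.20) (p. 15); Thm. (3.1)(a) (p. 37)] -/
theorem rcPartitionFunctionW_affine (w : Sym2 V → unitInterval) (q : ℝ) (e : Sym2 V) :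
    rcPartitionFunctionW w q ∅ =
      (1 - (w e : ℝ)) * rcPartitionFunctionW (Function.update w e 0) q ∅ +
        (w e : ℝ) * rcPartitionFunctionW (Function.update w e 1) q ∅ := by
  unfold rcPartitionFunctionW
  rw [Finset.mul_sum, Finset.mul_sum, ← Finset.sum_add_distrib]
  refine Finset.sum_congr rfl fun ω _ => ?_
  rw [rcWeightW_affine w q ∅ e ω]

/-- `φ(E) = S_w(E)/Z_w`, so an inequality between two measures of events is an inequality between cross-multiplied masses.
[cite: Grimmett2006, §1.4 eq. (1.20) (p. 15)] -/
theorem real_le_real_iff_mass {w w' : Sym2 V → unitInterval} {q : ℝ} (hq : 0 < q) (E E' : Set (BondConfig V)) :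
    (rcMeasureW w q ∅).real E ≤ (rcMeasureW w' q ∅).real E' ↔
      (∑ ω : BondConfig V, rcWeightW w q ∅ ω * ind E ω) * rcPartitionFunctionW w' q ∅ ≤
        (∑ ω : BondConfig V, rcWeightW w' q ∅ ω * ind E' ω) * rcPartitionFunctionW w q ∅ := by
  rw [rcMeasureW_real_eq_sum_div w hq ∅ E, rcMeasureW_real_eq_sum_div w' hq ∅ E',
    div_le_div_iff₀ (rcPartitionFunctionW_pos w hq ∅) (rcPartitionFunctionW_pos w' hq ∅)]

/-- In a RIGID state (every parameter is `0` or `1`) the weight is carried by the single configuration `{e | w e = 1}`.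
[cite: Grimmett2006, §1.4 eq. (1.20) (p. 15)] -/
theorem rcWeightW_eq_zero_of_rigid (w : Sym2 V → unitInterval) (q : ℝ)
    (hR : ∀ e : Sym2 V, (w e : ℝ) = 0 ∨ (w e : ℝ) = 1) {ω : BondConfig V} (hω : ω ≠ {e | (w e : ℝ) = 1}) :
    rcWeightW w q ∅ ω = 0 := by
  have : ∃ e, ¬ (e ∈ ω ↔ (w e : ℝ) = 1) := by
    by_contra h
    apply hω
    ext e
    exact not_not.mp fun hne => h ⟨e, hne⟩
  obtain ⟨e, he⟩ := this
  rcases hR e with h0 | h1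
  · have heω : e ∈ ω := by
      by_contra hne
      exact he ⟨fun h => absurd h hne, fun h => by rw [h0] at h; norm_num at h⟩
    exact rcWeightW_eq_zero_of_zero_mem w q ∅ h0 heω
  · have heω : e ∉ ω := fun hin => he ⟨fun _ => h1, fun _ => hin⟩
    exact rcWeightW_eq_zero_of_one_not_mem w q ∅ h1 heω

/-- In a rigid state every mass is `w_q(ω₁)·1_E(ω₁)` with `ω₁ = {e | w e = 1}`. [cite: Grimmett2006, §1.4 eq. (1.20) (p. 15)] -/
theorem sum_rcWeightW_ind_rigid (w : Sym2 V → unitInterval) (q : ℝ)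
    (hR : ∀ e : Sym2 V, (w e : ℝ) = 0 ∨ (w e : ℝ) = 1) (E : Set (BondConfig V)) :
    ∑ ω : BondConfig V, rcWeightW w q ∅ ω * ind E ω =
      rcWeightW w q ∅ {e | (w e : ℝ) = 1} * ind E {e | (w e : ℝ) = 1} := by
  rw [Finset.sum_eq_single_of_mem ({e | (w e : ℝ) = 1} : BondConfig V) (Finset.mem_univ _)]
  intro ω _ hω
  rw [rcWeightW_eq_zero_of_rigid w q hR hω, zero_mul]

/-! ### EC⁺ ⇒ pairwise positive correlation of two-point connection events (one-edge Bernstein induction) -/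

/-- **The one-edge Bernstein step for a pair of events** (pure algebra; prim-hp-7's identity (★) with the roles
`(A, b, a, B) ↦ (S(A∩B), Z, S(A), S(B))`): if the cross-multiplied inequality holds at both corner states and BOTH events gain
mass fraction when the pair is opened (`a₀Z₁ ≤ a₁Z₀`, `b₀Z₁ ≤ b₁Z₀`), it holds at every parameter `t ∈ [0,1]`. [folklore] -/
theorem pair_bernstein_step (A₀ A₁ a₀ a₁ b₀ b₁ Z₀ Z₁ t : ℝ) (ht0 : 0 ≤ t) (ht1 : t ≤ 1)
    (hQ0 : a₀ * b₀ ≤ Z₀ * A₀) (hQ1 : a₁ * b₁ ≤ Z₁ * A₁) (hLA : a₀ * Z₁ ≤ a₁ * Z₀) (hLB : b₀ * Z₁ ≤ b₁ * Z₀)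
    (hZ₀ : 0 < Z₀) (hZ₁ : 0 < Z₁) :
    ((1 - t) * a₀ + t * a₁) * ((1 - t) * b₀ + t * b₁) ≤ ((1 - t) * Z₀ + t * Z₁) * ((1 - t) * A₀ + t * A₁) := by
  have ht0' : 0 ≤ 1 - t := by linarith
  have ht1' : 1 - t ≤ 1 := by linarith
  have h := bernstein_step A₁ A₀ b₁ b₀ a₁ a₀ Z₁ Z₀ (1 - t) ht0' ht1' (by linarith) (by linarith) (by linarith)
    (by linarith) hZ₁ hZ₀
  have e1 : ((1 - (1 - t)) * A₁ + (1 - t) * A₀) * ((1 - (1 - t)) * Z₁ + (1 - t) * Z₀) -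
      ((1 - (1 - t)) * a₁ + (1 - t) * a₀) * ((1 - (1 - t)) * b₁ + (1 - t) * b₀) =
      ((1 - t) * Z₀ + t * Z₁) * ((1 - t) * A₀ + t * A₁) - ((1 - t) * a₀ + t * a₁) * ((1 - t) * b₀ + t * b₁) := by
    ring
  rw [e1] at h
  linarith

/-- EC⁺ in mass form: `S_{w[e↦0]}(x↔y)·Z_{w[e↦1]} ≤ S_{w[e↦1]}(x↔y)·Z_{w[e↦0]}`. [cite: Grimmett2006, Thm. (3.21) (p. 43); §3.9 (p. 63)] -/
theorem edgeConnMonoOn_mass {q : ℝ} (hq : 0 < q) (hEC : EdgeConnMonoOn V q) (w : Sym2 V → unitInterval)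
    (e : Sym2 V) (x y : V) :
    (∑ ω : BondConfig V, rcWeightW (Function.update w e 0) q ∅ ω * ind (openConn x y) ω) *
        rcPartitionFunctionW (Function.update w e 1) q ∅ ≤
      (∑ ω : BondConfig V, rcWeightW (Function.update w e 1) q ∅ ω * ind (openConn x y) ω) *
        rcPartitionFunctionW (Function.update w e 0) q ∅ :=
  (real_le_real_iff_mass hq _ _).1 (hEC w e x y)

/-- **The mass inequality** `S_w(x↔y)·S_w(u↔v) ≤ Z_w·S_w(x↔y, u↔v)` for every weight vector on `V`, from EC⁺ on `V` (strong
induction on the number of pairs with parameter in `(0,1)`; one-edge Bernstein step `pair_bernstein_step`).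
[cite: AyyerLinussonRavichandran2025, §7 eq. (13)–(15) (p. 22)] [cite: Grimmett2006, Thm. (3.1)(a) (p. 37)] -/
theorem pairConn_mass_le_of_edgeConnMonoOn {q : ℝ} (hq : 0 < q) (hEC : EdgeConnMonoOn V q)
    (w : Sym2 V → unitInterval) (x y u v : V) :
    (∑ ω : BondConfig V, rcWeightW w q ∅ ω * ind (openConn x y) ω) *
        (∑ ω : BondConfig V, rcWeightW w q ∅ ω * ind (openConn u v) ω) ≤
      rcPartitionFunctionW w q ∅ *
        ∑ ω : BondConfig V, rcWeightW w q ∅ ω * ind (openConn x y ∩ openConn u v) ω := by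
  -- the number of fractional pairs
  set cF : (Sym2 V → unitInterval) → ℕ := fun w =>
    (Finset.univ.filter (fun p : Sym2 V => 0 < ((w p : unitInterval) : ℝ) ∧ ((w p : unitInterval) : ℝ) < 1)).card
    with hcF
  have main : ∀ (N : ℕ) (w : Sym2 V → unitInterval), cF w = N →
      (∑ ω : BondConfig V, rcWeightW w q ∅ ω * ind (openConn x y) ω) *
          (∑ ω : BondConfig V, rcWeightW w q ∅ ω * ind (openConn u v) ω) ≤
        rcPartitionFunctionW w q ∅ *
          ∑ ω : BondConfig V, rcWeightW w q ∅ ω * ind (openConn x y ∩ openConn u v) ω := by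
    intro N
    induction N using Nat.strong_induction_on with
    | _ N ih =>
    intro w hN
    -- measure decrease under pinning a fractional pair to `0` or `1`
    have hdec : ∀ (p₀ : Sym2 V) (c : unitInterval), ((c : ℝ) = 0 ∨ (c : ℝ) = 1) →
        (0 < ((w p₀ : unitInterval) : ℝ) ∧ ((w p₀ : unitInterval) : ℝ) < 1) → cF (Function.update w p₀ c) < N := by
      intro p₀ c hc hp₀
      rw [← hN]
      simp only [hcF]
      apply Finset.card_lt_card
      rw [Finset.ssubset_iff_of_subset]
      · refine ⟨p₀, Finset.mem_filter.2 ⟨Finset.mem_univ _, hp₀⟩, fun h => ?_⟩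
        have h' := (Finset.mem_filter.1 h).2
        simp only [Function.update_self] at h'
        rcases hc with hc | hc
        · linarith [h'.1]
        · linarith [h'.2]
      · intro p hp
        have h' := (Finset.mem_filter.1 hp).2
        by_cases hpp : p = p₀
        · subst hpp
          simp only [Function.update_self] at h'
          rcases hc with hc | hc
          · linarith [h'.1]
          · linarith [h'.2]
        · rw [Function.update_of_ne hpp] at h'
          exact Finset.mem_filter.2 ⟨Finset.mem_univ _, h'⟩
    by_cases hF0 : (Finset.univ.filter (fun p : Sym2 V =>
        0 < ((w p : unitInterval) : ℝ) ∧ ((w p : unitInterval) : ℝ) < 1)) = ∅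
    · -- BASE: rigid state, the measure is a point mass
      have hR : ∀ p : Sym2 V, ((w p : unitInterval) : ℝ) = 0 ∨ ((w p : unitInterval) : ℝ) = 1 := by
        intro p
        by_contra hcon
        have hne0 : ((w p : unitInterval) : ℝ) ≠ 0 := fun h => hcon (Or.inl h)
        have hne1 : ((w p : unitInterval) : ℝ) ≠ 1 := fun h => hcon (Or.inr h)
        have hw0 : 0 ≤ ((w p : unitInterval) : ℝ) := (w p).2.1
        have hw1 : ((w p : unitInterval) : ℝ) ≤ 1 := (w p).2.2
        have : p ∈ Finset.univ.filter (fun p : Sym2 V =>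
            0 < ((w p : unitInterval) : ℝ) ∧ ((w p : unitInterval) : ℝ) < 1) :=
          Finset.mem_filter.2 ⟨Finset.mem_univ _, lt_of_le_of_ne hw0 hne0.symm, lt_of_le_of_ne hw1 hne1⟩
        rw [hF0] at this
        exact absurd this (Finset.notMem_empty _)
      rw [sum_rcWeightW_ind_rigid w q hR (openConn x y), sum_rcWeightW_ind_rigid w q hR (openConn u v),
        sum_rcWeightW_ind_rigid w q hR (openConn x y ∩ openConn u v)]
      have hZ : rcPartitionFunctionW w q ∅ = rcWeightW w q ∅ {e | ((w e : unitInterval) : ℝ) = 1} := by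
        have h := sum_rcWeightW_ind_rigid w q hR Set.univ
        simp only [ind_of_mem (Set.mem_univ _), mul_one] at h
        exact h
      rw [hZ, ← Literature.Probability.Percolation.TwoAvoidanceSets.ind_mul_ind (openConn x y) (openConn u v)]
      exact le_of_eq (by ring)
    · -- STEP: deform a fractional pair `e`
      obtain ⟨e, heF⟩ := Finset.nonempty_iff_ne_empty.2 hF0
      obtain ⟨he0, he1⟩ := (Finset.mem_filter.1 heF).2
      rw [sum_rcWeightW_ind_affine w q e (openConn x y ∩ openConn u v), sum_rcWeightW_ind_affine w q e (openConn x y),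
        sum_rcWeightW_ind_affine w q e (openConn u v), rcPartitionFunctionW_affine w q e]
      -- corner states (induction), EC⁺ at the pair `e` for both events, positivity of the corner partition functions
      exact pair_bernstein_step _ _ _ _ _ _ _ _ _ he0.le he1.le
        (ih _ (hdec e 0 (Or.inl rfl) ⟨he0, he1⟩) (Function.update w e 0) rfl)
        (ih _ (hdec e 1 (Or.inr rfl) ⟨he0, he1⟩) (Function.update w e 1) rfl)
        (edgeConnMonoOn_mass hq hEC w e x y) (edgeConnMonoOn_mass hq hEC w e u v)
        (rcPartitionFunctionW_pos (Function.update w e 0) hq ∅) (rcPartitionFunctionW_pos (Function.update w e 1) hq ∅)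
  exact main _ w rfl

/-- **EC⁺ on `V` ⇒ pairwise positive correlation of two-point connection events on `V`**, every `q > 0`, every weight vector:
`φ_{w,q}(x ↔ y)·φ_{w,q}(u ↔ v) ≤ φ_{w,q}(x ↔ y, u ↔ v)`. [cite: AyyerLinussonRavichandran2025, §7 eq. (13)–(15), Conj. 7.1 (p. 22)]
[cite: Grimmett2006, §3.9 (p. 63)] -/
theorem pairConnPosUnder_of_edgeConnMonoOn {q : ℝ} (hq : 0 < q) (hEC : EdgeConnMonoOn V q)
    (w : Sym2 V → unitInterval) (x y u v : V) : PairConnPosUnder (rcMeasureW w q ∅) x y u v := by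
  haveI := isProbabilityMeasure_rcMeasureW w hq (∅ : Set V)
  unfold PairConnPosUnder
  rw [probReal_univ, one_mul, rcMeasureW_real_eq_sum_div w hq ∅ (openConn x y), rcMeasureW_real_eq_sum_div w hq ∅ (openConn u v),
    rcMeasureW_real_eq_sum_div w hq ∅ (openConn x y ∩ openConn u v)]
  have hZ := rcPartitionFunctionW_pos w hq (∅ : Set V)
  rw [div_mul_div_comm, div_le_div_iff₀ (mul_pos hZ hZ) hZ]
  have h := pairConn_mass_le_of_edgeConnMonoOn hq hEC w x y u v
  calc (∑ ω : BondConfig V, rcWeightW w q ∅ ω * ind (openConn x y) ω) *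
          (∑ ω : BondConfig V, rcWeightW w q ∅ ω * ind (openConn u v) ω) * rcPartitionFunctionW w q ∅
      ≤ (rcPartitionFunctionW w q ∅ * ∑ ω : BondConfig V, rcWeightW w q ∅ ω * ind (openConn x y ∩ openConn u v) ω) *
          rcPartitionFunctionW w q ∅ := mul_le_mul_of_nonneg_right h hZ.le
    _ = (∑ ω : BondConfig V, rcWeightW w q ∅ ω * ind (openConn x y ∩ openConn u v) ω) *
          (rcPartitionFunctionW w q ∅ * rcPartitionFunctionW w q ∅) := by ring

/-- **EC⁺ ⇒ pairwise positive correlation of two-point connection events** (`q`-families over all `Fin n`), every `q > 0`: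
Ayyer–Linusson–Ravichandran's (13)/(15) and the hub inequality follow from single-edge monotonicity alone.
[cite: AyyerLinussonRavichandran2025, §7 eq. (13)–(15), Conj. 7.1 (p. 22)] [cite: Grimmett2006, §3.9 (p. 63)] -/
theorem pairConnPosFK_of_edgeConnMonoFK {q : ℝ} (hq : 0 < q) (hEC : EdgeConnMonoFK q) : PairConnPosFK q :=
  fun n w x y u v => pairConnPosUnder_of_edgeConnMonoOn hq (hEC n) w x y u v

/-- **EC⁺ ⇒ the hub inequality** `φ(o ↔ a)φ(b ↔ a) ≤ φ(o ↔ a ↔ b)` (Ayyer–Linusson–Ravichandran (13); Harris' inequality shape).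
[cite: AyyerLinussonRavichandran2025, §7 eq. (13) (p. 22)] -/
theorem hubFK_of_edgeConnMonoFK {q : ℝ} (hq : 0 < q) (hEC : EdgeConnMonoFK q) : HubFK q :=
  hubFK_of_pairConnPosFK (pairConnPosFK_of_edgeConnMonoFK hq hEC)

/-- The conjecture nodes: EC⁺ for every `q > 0` gives pairwise positive correlation of connection events for every `q > 0`.
[cite: AyyerLinussonRavichandran2025, §7 Conj. 7.1 (p. 22)] -/
theorem pairConnPosFKPos_of_edgeConnMonoFKPos (h : EdgeConnMonoFKPos) : PairConnPosFKPos :=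
  fun q hq => pairConnPosFK_of_edgeConnMonoFK hq (h q hq)

/-- … and in particular the hub conjecture node. [cite: AyyerLinussonRavichandran2025, §7 eq. (13), Conj. 7.1 (p. 22)] -/
theorem hubFKPos_of_edgeConnMonoFKPos (h : EdgeConnMonoFKPos) : HubFKPos :=
  hubFKPos_of_pairConnPosFKPos (pairConnPosFKPos_of_edgeConnMonoFKPos h)

/-! ### EC⁺ as monotonicity in all the parameters, and the `q ≥ 1` discharge -/

/-- Along one coordinate the connection probability is a ratio of affine functions; under EC⁺ it is monotone:
`c ≤ c'` ⇒ `φ_{w[e↦c]}(x↔y) ≤ φ_{w[e↦c']}(x↔y)`. [cite: Grimmett2006, Thm. (3.21) (p. 43); §3.9 (p. 63)] -/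
theorem rcMeasureW_real_openConn_mono_update {q : ℝ} (hq : 0 < q) (hEC : EdgeConnMonoOn V q) (w : Sym2 V → unitInterval)
    (e : Sym2 V) (x y : V) {c c' : unitInterval} (hcc : c ≤ c') :
    (rcMeasureW (Function.update w e c) q ∅).real (openConn x y) ≤
      (rcMeasureW (Function.update w e c') q ∅).real (openConn x y) := by
  rw [real_le_real_iff_mass hq]
  have sA : ∀ d : unitInterval, ∑ ω : BondConfig V, rcWeightW (Function.update w e d) q ∅ ω * ind (openConn x y) ω =
      (1 - (d : ℝ)) * ∑ ω : BondConfig V, rcWeightW (Function.update w e 0) q ∅ ω * ind (openConn x y) ω +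
        (d : ℝ) * ∑ ω : BondConfig V, rcWeightW (Function.update w e 1) q ∅ ω * ind (openConn x y) ω := by
    intro d
    have h := sum_rcWeightW_ind_affine (Function.update w e d) q e (openConn x y)
    simp only [Function.update_idem, Function.update_self] at h
    exact h
  have sZ : ∀ d : unitInterval, rcPartitionFunctionW (Function.update w e d) q ∅ =
      (1 - (d : ℝ)) * rcPartitionFunctionW (Function.update w e 0) q ∅ +
        (d : ℝ) * rcPartitionFunctionW (Function.update w e 1) q ∅ := by
    intro d
    have h := rcPartitionFunctionW_affine (Function.update w e d) q e
    simp only [Function.update_idem, Function.update_self] at h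
    exact h
  rw [sA c, sA c', sZ c, sZ c']
  have hL := edgeConnMonoOn_mass hq hEC w e x y
  have hcc' : (c : ℝ) ≤ (c' : ℝ) := hcc
  have hc0 : 0 ≤ (c : ℝ) := c.2.1
  have hc1 : (c' : ℝ) ≤ 1 := c'.2.2
  -- `((1-c)a₀ + c a₁)((1-c')Z₀ + c'Z₁) ≤ ((1-c')a₀ + c'a₁)((1-c)Z₀ + cZ₁)` ⟺ `(c' − c)(a₀Z₁ − a₁Z₀) ≤ 0`
  nlinarith [hL, hcc', hc0, hc1]

/-- **Under EC⁺, two-point connection probabilities are non-decreasing in all the edge parameters**: `w ≤ w'` pointwise ⇒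
`φ_{w,q}(x ↔ y) ≤ φ_{w',q}(x ↔ y)`.  For `q < 1` this is exactly what is missing in print (Grimmett 2006 §5.8).
[cite: Grimmett2006, Thm. (3.21) (p. 43); §5.8 (p. 131)] -/
theorem rcMeasureW_real_openConn_mono_of_edgeConnMonoOn {q : ℝ} (hq : 0 < q) (hEC : EdgeConnMonoOn V q)
    {w w' : Sym2 V → unitInterval} (hww : ∀ e, w e ≤ w' e) (x y : V) :
    (rcMeasureW w q ∅).real (openConn x y) ≤ (rcMeasureW w' q ∅).real (openConn x y) := by
  -- change the coordinates one at a time along an enumeration of the pairs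
  suffices h : ∀ (s : Finset (Sym2 V)) (w w' : Sym2 V → unitInterval), (∀ e, w e ≤ w' e) → (∀ e ∉ s, w e = w' e) →
      (rcMeasureW w q ∅).real (openConn x y) ≤ (rcMeasureW w' q ∅).real (openConn x y) from
    h Finset.univ w w' hww (fun e he => absurd (Finset.mem_univ e) he)
  intro s
  induction s using Finset.induction_on with
  | empty =>
    intro w w' _ heq
    have : w = w' := funext fun e => heq e (Finset.notMem_empty e)
    rw [this]
  | @insert e s hes ih =>
    intro w w' hww heq
    -- intermediate vector: `w` with the coordinate `e` raised to `w' e`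
    have h1 : (rcMeasureW w q ∅).real (openConn x y) ≤ (rcMeasureW (Function.update w e (w' e)) q ∅).real (openConn x y) := by
      have h := rcMeasureW_real_openConn_mono_update hq hEC w e x y (hww e)
      rw [Function.update_eq_self] at h
      exact h
    have h2 : (rcMeasureW (Function.update w e (w' e)) q ∅).real (openConn x y) ≤ (rcMeasureW w' q ∅).real (openConn x y) := by
      refine ih (Function.update w e (w' e)) w' (fun f => ?_) (fun f hf => ?_)
      · by_cases hfe : f = e
        · subst hfe; rw [Function.update_self]
        · rw [Function.update_of_ne hfe]; exact hww f
      · by_cases hfe : f = e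
        · subst hfe; rw [Function.update_self]
        · rw [Function.update_of_ne hfe]
          exact heq f (fun h => (Finset.mem_insert.1 h).elim hfe hf)
    exact h1.trans h2

/-- **EC⁺ holds for `q ≥ 1`** — the comparison inequality in `𝐩` (Grimmett 2006, Thm. (3.21)) for the increasing event `{x ↔ y}`
(tree: `rcMeasureW_real_mono_weights`). [cite: Grimmett2006, Thm. (3.21) (p. 43)] -/
theorem edgeConnMonoOn_of_one_le {q : ℝ} (hq : 1 ≤ q) : EdgeConnMonoOn V q := by
  intro w e x y
  refine rcMeasureW_real_mono_weights (fun f => ?_) hq ∅ ?_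
  · by_cases hfe : f = e
    · subst hfe
      rw [Function.update_self, Function.update_self]
      exact Subtype.coe_le_coe.mp (by norm_num)
    · rw [Function.update_of_ne hfe, Function.update_of_ne hfe]
  · intro ω ω' hle hω
    exact SimpleGraph.Reachable.mono (SimpleGraph.fromEdgeSet_mono hle) hω

/-- EC⁺ for every finite weighted graph, `q ≥ 1`. [cite: Grimmett2006, Thm. (3.21) (p. 43)] -/
theorem edgeConnMonoFK_of_one_le {q : ℝ} (hq : 1 ≤ q) : EdgeConnMonoFK q := fun _ => edgeConnMonoOn_of_one_le hq

/-- Hence a second proof of pairwise positive correlation of connection events for `q ≥ 1` that uses only single-edge monotonicity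
(no positive association of the pair of events). [cite: Grimmett2006, Thm. (3.8), Thm. (3.21) (p. 43)] -/
theorem pairConnPosFK_of_one_le' {q : ℝ} (hq : 1 ≤ q) : PairConnPosFK q :=
  pairConnPosFK_of_edgeConnMonoFK (one_pos.trans_le hq) (edgeConnMonoFK_of_one_le hq)

end FK

end Summit.CriticalPhenomena.PercolationContinuityZ3.Theorems

end
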